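import Summits.BirchSwinnertonDyer.BirchSwinnertonDyer.Theorems.SylvesterTwoHeegnerIndexTwoAdicPairEngine
import Summits.BirchSwinnertonDyer.BirchSwinnertonDyer.Theorems.SylvesterTwoHeegnerIndexTwoAdicPairOddIndex
import Summits.BirchSwinnertonDyer.BirchSwinnertonDyer.Theorems.SylvesterTwoHeegnerIndexHalvabilityFlag
import HarnessLib

/-!
# Route `SylvesterTwoHeegnerIndex` (rung K7t), item 19580 `TwoAdicPairHSY`:
# the DESCENT ENGINE — `ιP ∉ 2E_p(K) + tors` and the bound `i ≤ ord₂ q` over a quadratic `K ∋ ω`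

HONEST FRAMING (cell b2b-bsdres, seat x1b GEN 48 = O12 class lead; `--supports
stmt-BirchSwinnertonDyer-19580`). Sequel of `…TwoAdicPairEngine.lean` (parity engine) and
`…TwoAdicPairOddIndex.lean` (odd-index lemma as group theory). FACT-FREE (no named fact, no
definition). Item 19580 is OPEN and STAYS OPEN here; the sequel `…TwoAdicPairOfHeightDisplay.lean`
feeds Hu–Shu–Yin's display (bsd) into these engines.

* `descends_of_generator` — on a model over a quadratic `K`, every point fixed by the conjugation is
  `≡ m·P` modulo torsion when `P` generates `B(ℚ)` modulo torsion (Galois descent of points = the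
  tree's `exists_incl_eq_of_conjMap_eq`, p432457; equivariance of `VariableChange.pointEquivBaseChange`);
* **`le_padicValRat_two_of_model`** — THE ENGINE: `K/ℚ` quadratic with a conjugation datum and
  `ω ∈ K`, `B ≅ E_p` (`p` an odd prime), `P ∈ B(ℚ)` a generator modulo torsion with `ιP` non-torsion,
  `rank_ℤ B(K) = 2`, `q·ĥ_K(ιP) = 2^i·ĥ_K(Y)` ⇒ `i ≤ ord₂ q` (no `2`-torsion = the tree's
  `two_torsion_eq_zero_of_model_of_finrank_eq_two`, p423972; `ιP ∉ 2E(K) + tors` by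
  `not_exists_eq_two_smul_add_torsion`; odd-index lemma; explicit quotient).

WHAT THIS IS NOT: not 19580 for any `p`; nothing about `Ш`; nothing booked, no label moves.
References: [HuShuYin2019] pp. 2, 8, 12; [SilvermanAEC2009] VIII.9.3, Exercise 10.16.
-/

set_option autoImplicit false
-- the Summit-side namespace `Summit.BirchSwinnertonDyer.BirchSwinnertonDyer.…` (summit = problem) is mandated by D-0017
set_option linter.dupNamespace false

noncomputable section

open scoped Classical

open WeierstrassCurve WeierstrassCurve.Affine WeierstrassCurve.Affine.Point
  Literature.NumberTheory.EllipticCurves Literature.NumberTheory.EllipticCurves.HuShuYin2019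
  Literature.NumberTheory.QuadraticFields
  Summit.BirchSwinnertonDyer.BirchSwinnertonDyer.Theses.SylvesterTwoHeegnerIndex

namespace Summit.BirchSwinnertonDyer.BirchSwinnertonDyer.Theorems.SylvesterTwoCMNormForm


/-! ## §10 The engine over a quadratic field `K ∋ ω`: descent of the `σ`-fixed part and the bound -/

section Engine

variable {K : Type*} [Field K] [NumberField K]

/-- **The descent hypothesis on Hu–Shu–Yin's model.** For `K/ℚ` quadratic (`K = ℚ(θ₀)`, `θ₀² = c`),
a model `B` with `C • B = E_{n₀}` (Mordell form) and `P ∈ B(ℚ)` generating `B(ℚ)` modulo torsion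
(stated through `ι : B(ℚ) → B(K)`), every point of `((C • B)_K)(K)` fixed by the conjugation `σ` is
`≡ m·φ(ιP)` modulo torsion, `φ = pointEquivBaseChange B C K` — by the Galois descent of points (the
tree's `exists_incl_eq_of_conjMap_eq`) and the equivariance of `φ` (`pointEquivBaseChange_map`).
[cite: SilvermanAEC2009, Exercise 10.16] -/
theorem descends_of_generator [NeZero (2 : ℚ)] (h2 : Module.finrank ℚ K = 2) {θ₀ : K} {c : ℚ}
    (hθ₀ : θ₀ ∉ Set.range (algebraMap ℚ K)) (hc : θ₀ ^ 2 = algebraMap ℚ K c)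
    (B : WeierstrassCurve ℚ) (C : VariableChange ℚ) {P : B.toAffine.Point}
    (hgen : ∀ Q : B.toAffine.Point, ∃ m : ℤ, IsOfFinAddOrder
      (WeierstrassCurve.QuadraticDescent.incl K B Q - m • WeierstrassCurve.QuadraticDescent.incl K B P))
    (X : ((C • B).baseChange K).toAffine.Point)
    (hX : WeierstrassCurve.QuadraticDescent.conjMap (C • B) (Quadratic.conj h2 hθ₀ hc) X = X) :
    ∃ m : ℤ, IsOfFinAddOrder (X - m • VariableChange.pointEquivBaseChange B C K
      (WeierstrassCurve.QuadraticDescent.incl K B P)) := by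
  set φ := VariableChange.pointEquivBaseChange B C K with hφ
  -- `φ⁻¹ X` is `σ`-fixed
  have hX' : WeierstrassCurve.QuadraticDescent.conjMap B (Quadratic.conj h2 hθ₀ hc) (φ.symm X) =
      φ.symm X := by
    apply φ.injective
    rw [AddEquiv.apply_symm_apply]
    have h := VariableChange.pointEquivBaseChange_map B C (Quadratic.conj h2 hθ₀ hc) (φ.symm X)
    rw [AddEquiv.apply_symm_apply] at h
    -- `h : Point.map σ X = φ (Point.map σ (φ.symm X))`
    rw [← hφ] at h
    exact (h.symm.trans hX)
  obtain ⟨Q, hQ⟩ := Summit.BirchSwinnertonDyer.BirchSwinnertonDyer.Theorems.SylvesterTwoHalvability.exists_incl_eq_of_conjMap_eq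
    h2 hθ₀ hc B (φ.symm X) hX'
  obtain ⟨m, hm⟩ := hgen Q
  refine ⟨m, ?_⟩
  have h := φ.toAddMonoidHom.isOfFinAddOrder hm
  rw [AddEquiv.coe_toAddMonoidHom, map_sub, map_zsmul, hQ, AddEquiv.apply_symm_apply] at h
  exact h

/-- **THE ENGINE (lower bound).** `K/ℚ` quadratic with a conjugation datum (`θ₀² = c ∈ ℚ`, `θ₀ ∉ ℚ`)
and `ω ∈ K` (`ω² + ω + 1 = 0`); `B` a model of `E_p` (`C • B = y² = x³ − 432p²`, `p` an odd prime);
`P ∈ B(ℚ)` non-torsion in `B(K)` and generating `B(ℚ)` modulo torsion; `rank_ℤ B(K) = 2`; `Y ∈ B(K)`;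
`q ≠ 0` rational with `q·ĥ_K(ιP) = 2^i·ĥ_K(Y)`. Then `i ≤ ord₂ q`. (Transport to the Mordell model;
`[ω]`; no `2`-torsion (`two_torsion_eq_zero_of_model_of_finrank_eq_two`); `ιP ∉ 2E(K) + tors` by
descent; odd-index lemma; explicit quotient.) [cite: HuShuYin2019, p. 8, p. 12 (bsd)] -/
theorem le_padicValRat_two_of_model [NeZero (2 : ℚ)] (h2 : Module.finrank ℚ K = 2) {θ₀ : K} {c : ℚ}
    (hθ₀ : θ₀ ∉ Set.range (algebraMap ℚ K)) (hc : θ₀ ^ 2 = algebraMap ℚ K c) {ω : K}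
    (hω : ω ^ 2 + ω + 1 = 0) {p : ℕ} (hp : p.Prime) (hp2 : p ≠ 2) (B : WeierstrassCurve ℚ)
    [B.IsElliptic] (C : VariableChange ℚ) (hC : C • B = cubeSumCurve (p : ℚ))
    (hrank : (B.baseChange K).mordellWeilRank = 2) {P : B.toAffine.Point}
    (hP : ¬IsOfFinAddOrder (WeierstrassCurve.QuadraticDescent.incl K B P))
    (hgen : ∀ Q : B.toAffine.Point, ∃ m : ℤ, IsOfFinAddOrder
      (WeierstrassCurve.QuadraticDescent.incl K B Q - m • WeierstrassCurve.QuadraticDescent.incl K B P))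
    (Y : (B.baseChange K).toAffine.Point) {q : ℚ} (hq : q ≠ 0) {i : ℤ}
    (hid : (q : ℝ) * canonicalHeight (WeierstrassCurve.QuadraticDescent.incl K B P) =
      (2 : ℝ) ^ i * canonicalHeight Y) :
    i ≤ padicValRat 2 q := by
  -- the Mordell model `W' = (C • B)_K` and the transport `φ`
  have ha1 : ((C • B).baseChange K).a₁ = 0 := by rw [hC]; simp [cubeSumCurve, WeierstrassCurve.baseChange]
  have ha2 : ((C • B).baseChange K).a₂ = 0 := by rw [hC]; simp [cubeSumCurve, WeierstrassCurve.baseChange]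
  have ha3 : ((C • B).baseChange K).a₃ = 0 := by rw [hC]; simp [cubeSumCurve, WeierstrassCurve.baseChange]
  have ha4 : ((C • B).baseChange K).a₄ = 0 := by rw [hC]; simp [cubeSumCurve, WeierstrassCurve.baseChange]
  haveI hBK : (B.baseChange K).IsElliptic := inferInstanceAs (B.map (algebraMap ℚ K)).IsElliptic
  haveI hCBK : ((C • B).baseChange K).IsElliptic :=
    inferInstanceAs ((C • B).map (algebraMap ℚ K)).IsElliptic
  set φ := VariableChange.pointEquivBaseChange B C K with hφdef
  have hφh : ∀ X, canonicalHeight (φ X) = canonicalHeight X := fun X =>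
    canonicalHeight_pointEquivBaseChange B C X
  -- `[ω]`
  obtain ⟨θ, hθ⟩ := exists_omegaRot (W := (C • B).baseChange K) hω ha1 ha2 ha3 ha4
  have hθ0 : (θ : _ → _) 0 = 0 := map_zero θ
  have hθ3 : ∀ X, θ.toAddMonoidHom (θ.toAddMonoidHom X) + θ.toAddMonoidHom X + X = 0 := fun X =>
    omegaRot_omegaRot_add_omegaRot_add hω ha1 ha2 ha3 ha4 hθ0 hθ (omega_ne_one hω) X
  -- `P' = φ(ιP)`: non-torsion
  set P' := φ (WeierstrassCurve.QuadraticDescent.incl K B P) with hP'def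
  have hP' : ¬IsOfFinAddOrder P' := fun h =>
    hP ((φ.injective.isOfFinAddOrder_iff (f := φ.toAddMonoidHom)).mp h)
  -- conjugation on `W'(K)`, no `2`-torsion, `P'` fixed, descent ⇒ `P' ∉ 2W'(K) + tors`
  have h2tor : ∀ X : ((C • B).baseChange K).toAffine.Point, 2 • X = 0 → X = 0 :=
    Summit.BirchSwinnertonDyer.BirchSwinnertonDyer.Theorems.SylvesterTwoFrame.two_torsion_eq_zero_of_model_of_finrank_eq_two
      K h2 hp hp2 (C • B) ⟨1, by rw [one_smul, hC]⟩
  have hσσ : ∀ X, WeierstrassCurve.QuadraticDescent.conjMap (C • B) (Quadratic.conj h2 hθ₀ hc)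
      (WeierstrassCurve.QuadraticDescent.conjMap (C • B) (Quadratic.conj h2 hθ₀ hc) X) = X :=
    WeierstrassCurve.QuadraticDescent.conjMap_conjMap (C • B) (Quadratic.conj_conj h2 hθ₀ hc)
  have hσP : WeierstrassCurve.QuadraticDescent.conjMap (C • B) (Quadratic.conj h2 hθ₀ hc) P' = P' := by
    rw [hP'def, hφdef]
    show Affine.Point.map _ (VariableChange.pointEquivBaseChange B C K _) = _
    rw [VariableChange.pointEquivBaseChange_map]
    exact congrArg (VariableChange.pointEquivBaseChange B C K)
      (WeierstrassCurve.QuadraticDescent.conjMap_incl B (Quadratic.conj h2 hθ₀ hc) P)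
  have hP2 : ¬ ∃ (Q T : ((C • B).baseChange K).toAffine.Point), IsOfFinAddOrder T ∧ P' = 2 • Q + T :=
    not_exists_eq_two_smul_add_torsion
      (WeierstrassCurve.QuadraticDescent.conjMap (C • B) (Quadratic.conj h2 hθ₀ hc)) hσσ h2tor hP' hσP
      (fun X hX => descends_of_generator h2 hθ₀ hc B C hgen X hX)
  -- the `K`-line and the odd representative
  have hr : Module.finrank ℤ ((C • B).baseChange K).toAffine.Point = 2 := by
    rw [← φ.toIntLinearEquiv.finrank_eq]
    exact hrank
  obtain ⟨n, a, b, hn, hY'⟩ :=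
    exists_zsmul_eq_of_finrank_eq_two hω ha1 ha2 ha3 ha4 hθ0 hθ hr hP' (φ Y)
  obtain ⟨n', a', b', T', hodd, hT', hY''⟩ := exists_odd_zsmul_eq θ.toAddMonoidHom hθ3 P' hP2
    n.natAbs le_rfl hn IsOfFinAddOrder.zero hY'
  -- the height identity on `W'` and the bound
  have hid' : (q : ℝ) * canonicalHeight P' = (2 : ℝ) ^ i * canonicalHeight (φ Y) := by
    rw [hP'def, hφh, hφh]; exact hid
  exact le_padicValRat_two_of_height_identity_of_odd hω ha1 ha2 ha3 ha4 hθ0 hθ hP' hT' hodd hY'' hq hid'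

end Engine


end Summit.BirchSwinnertonDyer.BirchSwinnertonDyer.Theorems.SylvesterTwoCMNormForm

end
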